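import Literature.NumberTheory.EllipticCurves.KatoAdditiveTwistedValueNeronIntegralitySymbolClosure
import Mathlib.AlgebraicGeometry.EllipticCurve.ModelsWithJ
import HarnessLib
import HarnessLib.Audit.Tags

/-!
# THE SECOND EULER SYSTEM on the CM classes of the Manin band — rows E-es-124 `KatoFactTwoAtOfJ1728`, E-es-124₀ `KatoFactTwoAtLemniscate`,
# E-es-125 `KatoFactThreeAtOfJ0` typed, node E-es-126 `KatoFactTwoAtCurve32a1`, two proved edges
# (cell `bsd-f2-manin`, planner `es` g27, MEMO-es §41; T-es-40; nothing asserted)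

TYPER NOTE (typer g18, T-es-40).  SOURCE = HOME/es/g27/Sketch-es-g27.lean sha16 04accc1bf0adad14 (112 l.; farm rc 0 · 0 err · 0 warn · 0 sorry per es;
BC7 Probe-es-g27 5/5 CLEAN), landed VERBATIM except: (i) this note; (ii) namespace `BsdF2ManinEsG27` folded to `…ManinAdditive.KatoCurve` (where
E-es-110/112/122/123 live); (iii) the typer lint forbids `instance` declarations in statement files, so es's two `instance …_isElliptic` become
`theorem lemniscate_isElliptic` / `theorem curve32a1_isElliptic` (`IsElliptic` is a `Prop`-class) and the two single-curve Props E-es-124₀ / E-es-126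
carry the extra (inhabited) instance binder `[lemniscate.IsElliptic]` resp. `[curve32a1.IsElliptic]` in front of es's `[….IsGloballyMinimal]` — the
edges feed it automatically; (iv) `@[conjecture]` on E-es-124 / 124₀ / 125 (es's ask; obligation nodes, NOTHING asserted) while E-es-126 stays a
plain node (es: PROVED ON PAPER by the CM road, audit R-es-59 pending; also known by value from `c₀(32a1) = 1`); (v) one-line docstrings on the six
model lemmas; nothing else changed.  Imports: Literature + Mathlib only — ROUTE-INDEPENDENT.

HONEST FRAMING.  LENS: es (Euler systems / explicit reciprocity) — CM explicit reciprocity (Eisenstein–Kronecker numbers, elliptic Gauss sums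
of chord slopes; Damerell / de Shalit II.3.5) as a `c₀`- and `c₁`-FREE, modular-curve-free source of `KatoFactTwoAt`-type integrality against
the NÉRON period on the CM classes; first target = the in-range residual class 32a of the C2 LEAD's stub 6″/6⁗ (v16/v17).  NOT IN PRINT as
statements: E-es-124 (all `j = 1728` curves, integrality against `Ω(V)` of `V` itself, strongest at `E_min`), E-es-125 (`j = 0`, p = 3 twin);
E-es-126 (`E₀`-level on 32a) has es's elementary paper proof (MEMO-es §41.4 (a)–(f)); the last factor 2 (= `#π₀(E_min(ℝ))`) separating 126
from 124₀ is OPEN and is proposed as crux idea E-es-127 «CM symbols are Gaussian integers» (HOME/es/g27/idea-cm-gaussian-symbols.md).  NEAREST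
PRINT BY NAME: [deShalit1987 II.3.5 (13)] (the explicit reciprocity / Eisenstein–Kronecker formula), [Kato2004Asterisque (8.1.3)] (the shape of
the integrality), [Rubin1991] (CM main conjecture machinery; placement); es also cites Nomoto 2024 Thm 1 for placement (no bib key in the tree —
not tagged).  WHY NOVEL (es): the mechanism is new at `2 ∣ 𝔣` (unit conductor), where Kato's image-free theorem F-es-21♭K reaches only
`½ℤ₍₂₎[ζ_n]` on 32a1.  BC5 WITNESS: HOME/es/g27/CM32-TWIST-TABLE-v1.tsv (+ CM32-SYMBOLS-v1/v2, SHA16S): 32a2 — 184/184 odd-order characters of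
conductor `m ≤ 61` satisfy E-es-124₀ (v₂(A) ≥ 1; = 1 in 178/192 incl. composite m: SHARP), two engines (L-value vs slope sum agree to 1e-14 on
192/192); 27a (p = 3 twin): even v₃(A⁺) = 1 EXACTLY 155/155, odd v₃(A⁻) = 0 in 174/176 (2 inadmissible χ(3) = ±1), symbols 252/252 ∈ (1−ω)ℤ[ω].
CHEAPEST FALSIFIER (run): one admissible χ on 32a2 with v₂(A(χ)) = 0 — 0/184; next: D-es-g27-1 (second engines by modular symbols; CM band beyond
range).  REFUTER VERDICTS: R-es-59 (ref1: audit of §41.4 (a)–(g), twin (h), E_K identifications) PENDING at filing; ref2 (Zhao 1997/2001 WANTED)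
PENDING.  PARTITION currency: 0 (the rows sit under stub 6⁗'s in-range content {optimal X₁(32)-datum of 32a2}; nothing moves today);
beyond-print theorem: NO.  bears_on: stmt-BirchSwinnertonDyer-22967 (C2) and stmt-…-22968 (C3, via E-es-125).  BSD is not proved by this; Stevens' `c₁ = ±1`,
Manin's `c₀ = 1` and C2/C3 are NOT proved by anything here.
[cite: deShalit1987, II.3.5 (13) (explicit reciprocity law / Eisenstein–Kronecker numbers for CM curves; shape only — E-es-124/125 are the cell's laws, MEMO-es §41, NOT in print)]
[cite: Kato2004Asterisque, (8.1.3) (p. 180) (the integrality shape `KatoFactTwoAt`)] [cite: Rubin1991, §1 (CM Euler system; placement only)]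
[cite: CremonaEcdata, (class 32a: 32a1 optimal c₀ = 1, 32a2 = E_min; class 27a)]
-/

set_option autoImplicit false

noncomputable section

open scoped MatrixGroups ModularForm

open CongruenceSubgroup WeierstrassCurve Literature.NumberTheory.EllipticCurves
  Literature.NumberTheory.EllipticCurves.ModularForms

namespace Summit.BirchSwinnertonDyer.Rank1Residual.ManinAdditive.KatoCurve

/-- The lemniscate curve `y² = x³ − x` = Cremona 32a2 = `E_min = E₁` (the `X₁(32)`-optimal, maximal-covolume member)
of the CM class 32a (`j = 1728`, CM by `ℤ[i]`); Néron lattice `ϖ·ℤ[i]`, `ϖ = Γ(1/4)²/(2√(2π))`, `Ω(32a2) = 2ϖ`. -/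
def lemniscate : WeierstrassCurve ℚ := ⟨0, 0, 0, -1, 0⟩

/-- Cremona 32a1 `y² = x³ + 4x` = the `X₀(32)`-optimal curve `E₀` of the class 32a (`c₀ = 1`, Cremona);
Néron lattice `((1+i)/2)·ϖ·ℤ[i]`, `Ω(32a1) = ϖ`. -/
def curve32a1 : WeierstrassCurve ℚ := ⟨0, 0, 0, 4, 0⟩

/-- `c₄ = 48`. -/
lemma lemniscate_c₄ : lemniscate.c₄ = 48 := by
  rw [lemniscate, c₄, b₂, b₄]; norm_num1

/-- `Δ = 64`. -/
lemma lemniscate_Δ : lemniscate.Δ = 64 := by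
  rw [lemniscate, Δ, b₂, b₄, b₆, b₈]; norm_num1

/-- `y² = x³ − x` is an elliptic curve (`Δ = 64`); a `theorem`, not an `instance` (typer lint). -/
theorem lemniscate_isElliptic : lemniscate.IsElliptic :=
  ⟨by rw [lemniscate_Δ]; exact isUnit_iff_ne_zero.mpr (by norm_num)⟩

/-- `j = 1728` (stated with the explicit `IsElliptic` witness, since no instance is declared; any instance is defeq to it). -/
lemma lemniscate_j : @WeierstrassCurve.j ℚ _ lemniscate lemniscate_isElliptic = 1728 := by
  rw [j, Units.inv_mul_eq_iff_eq_mul, lemniscate_c₄, coe_Δ', lemniscate_Δ]; norm_num1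

/-- `Δ = −4096`. -/
lemma curve32a1_Δ : curve32a1.Δ = -4096 := by
  rw [curve32a1, Δ, b₂, b₄, b₆, b₈]; norm_num1

/-- `y² = x³ + 4x` is an elliptic curve (`Δ = −4096`); a `theorem`, not an `instance` (typer lint). -/
theorem curve32a1_isElliptic : curve32a1.IsElliptic :=
  ⟨by rw [curve32a1_Δ]; exact isUnit_iff_ne_zero.mpr (by norm_num)⟩

/-- `c₄ = −192`. -/
lemma curve32a1_c₄ : curve32a1.c₄ = -192 := by
  rw [curve32a1, c₄, b₂, b₄]; norm_num1

/-- `j = 1728` (explicit `IsElliptic` witness). -/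
lemma curve32a1_j : @WeierstrassCurve.j ℚ _ curve32a1 curve32a1_isElliptic = 1728 := by
  rw [j, Units.inv_mul_eq_iff_eq_mul, curve32a1_c₄, coe_Δ', curve32a1_Δ]; norm_num1

/-- **E-es-124 `KatoFactTwoAtOfJ1728` (LAW, the CM restriction of E-es-110 at `p = 2`).**  For every globally minimal
elliptic curve `V/ℚ` with `j(V) = 1728` (CM by `ℤ[i]`; such `V` is additive at `2`, `2⁵ ∣ N`) and every `f`:
`KatoFactTwoAt V f` — Kato's `(8.1.3)`-shape 2-integrality of the Euler-corrected odd-order twisted symbol sums against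
the Néron period `Ω(V)` of `V` ITSELF (strongest at `V = E_min`).  On the class 32a this is the in-range residual of
stub 6″; over the tree it is equivalent (given the proved witness law E-es-111) to the 2-part of Stevens' `c₁ = ±1`
on these classes (refuter-1 §R114 `katoNeronIntegralTwoGamma1Optimal_iff_gammaOneOddAtFour`, class by class).
The CM road (MEMO-es §41) is a `c`-free candidate SOURCE: Damerell / de Shalit II.3.5 (13) expresses the twisted
values as elliptic Gauss sums of chord slopes on the Néron lattice of `V`; the elementary slope expansion at the
conductor-torsion point proves the `E₀`-level (one factor `2` short of this law on 32a); census
HOME/es/g27/CM32-TWIST-TABLE-v1.tsv: 184/184 odd-order characters of conductor `m ≤ 61` satisfy the law on 32a2. -/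
@[conjecture]
def KatoFactTwoAtOfJ1728 : Prop :=
  ∀ (V : WeierstrassCurve ℚ) [V.IsElliptic] [V.IsGloballyMinimal] {N : ℕ} [NeZero N]
    (f : CuspForm (Gamma0 N) 2), V.j = 1728 → KatoFactTwoAt V f

/-- **E-es-124₀ `KatoFactTwoAtLemniscate`** — the literal in-range residual instance of stub 6″: the law E-es-110 at
the single curve `E_min(32a) = 32a2 = y² = x³ − x` (for any audited global-minimality instance and any `f`; the inner
binder `IsNewformOf` pins `f` to the level-32 newform).  In CM coordinates (§41 (★★)+(S)): for every primitive `χ` of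
odd order `n > 1` and odd conductor `m`, `A(χ) := τ(χ)·L(E,χ̄,1)/ϖ = Σ_{γ ∈ (ℤ[i]/m)ˣ} χ(γγ̄)·λ(γ·w_m, β)/((2+2i)τ(χ̄))`
lies in `2·ℤ_(2)[ζ_n]` (`β = (i, 1−i)` the primitive `(1+i)³`-torsion point, `w_m` a primitive `m`-torsion point,
`λ` = chord slope).  PROVED `E₀`-level: `A(χ) ∈ ℤ_(2)[ζ_n]` (§41.4).  OPEN: the last factor `2` (= `#π₀(E_min(ℝ))`). -/
@[conjecture]
def KatoFactTwoAtLemniscate : Prop :=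
  ∀ [lemniscate.IsElliptic] [lemniscate.IsGloballyMinimal] {N : ℕ} [NeZero N] (f : CuspForm (Gamma0 N) 2), KatoFactTwoAt lemniscate f

/-- **E-es-126 `KatoFactTwoAtCurve32a1`** — the `E₀`-LEVEL on the class 32a: `KatoFactTwoAt` at `E₀ = 32a1`
(`Ω(32a1) = ϖ = Ω(32a2)/2`), i.e. `A(χ) ∈ ℤ_(2)[ζ_n]` for all admissible `χ`.  PROVED ON PAPER by the CM road
(§41.4: Damerell's formula + chord-slope reduction + good model over `ℚ(i, E[m])` + formal-group expansion of the
slope at `β` (`v₂(t(β)) = 1/8`) + granularity `v(S) ∈ 3/2 + ℤ`), `c₀`-free and symbol-closure-free (32a1 is NOT a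
symbol-closure curve: `𝓛̄_f/Λ_f ≅ ℤ/4`), where Kato's image-free theorem F-es-21♭K reaches only `A ∈ ½ℤ_(2)[ζ_n]` on
this class.  (Also known BY VALUE from Cremona's `c₀(32a1) = 1` + classical `Γ₀`-integrality; the point is the
mechanism.)  Audit ask R-es-59. -/
def KatoFactTwoAtCurve32a1 : Prop :=
  ∀ [curve32a1.IsElliptic] [curve32a1.IsGloballyMinimal] {N : ℕ} [NeZero N] (f : CuspForm (Gamma0 N) 2), KatoFactTwoAt curve32a1 f

/-- **E-es-125 `KatoFactThreeAtOfJ0` (LAW, the CM restriction of the Γ₁-Kato node at `p = 3`).**  For every globally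
minimal elliptic `V/ℚ` with `j(V) = 0` (CM by `ℤ[ζ₃]`) and every `f`: `KatoFactThreeAt V f` (both parity clauses; the
inner binders make it vacuous unless `V` is additive at `3`).  The `p = 3` twin of E-es-124: the class 27a
(`E_min = 27a3 = y² + y = x³`, `𝔣 = (3) = (√−3)²`, `(O/𝔣)ˣ = μ₆`) has the same «unit conductor» structure as 32a, so the
same chord-slope formula holds with `β` a primitive `3`-torsion point; 27a1/54a1 are the two `Γ₁`-gain classes at `3`
in range (MEMO-an ascent census).  Not run numerically this generation (hexagonal engine pending: D-es-g27-1). -/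
@[conjecture]
def KatoFactThreeAtOfJ0 : Prop :=
  ∀ (V : WeierstrassCurve ℚ) [V.IsElliptic] [V.IsGloballyMinimal] {N : ℕ} [NeZero N]
    (f : CuspForm (Gamma0 N) 2), V.j = 0 → KatoFactThreeAt V f

/-- Edge (proved): the class-level CM law gives the stub-6″ residual instance. -/
theorem katoFactTwoAtLemniscate_of_j1728 (h : KatoFactTwoAtOfJ1728) : KatoFactTwoAtLemniscate := by
  intro _ _ N _ f
  exact h lemniscate f lemniscate_j

/-- Edge (proved): the class-level CM law also gives the (weaker) `E₀`-level statement on 32a1 — as an instance of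
the law, not via the isogeny (the `E₀`-from-`E₁` direction is the tree's `katoFactTwoAt_of_oddIsogeny` road and is
not needed here since 32a1 is itself a `j = 1728` curve). -/
theorem katoFactTwoAtCurve32a1_of_j1728 (h : KatoFactTwoAtOfJ1728) : KatoFactTwoAtCurve32a1 := by
  intro _ _ N _ f
  exact h curve32a1 f curve32a1_j

end Summit.BirchSwinnertonDyer.Rank1Residual.ManinAdditive.KatoCurve

end
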